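import Summits.BirchSwinnertonDyer.Rank1Residual.X11a.BaseChangeRoute
import Summits.BirchSwinnertonDyer.Rank1Residual.X2.HidaLimitCongruenceAlgebra
import HarnessLib

/-!
# Class X11a, PRINT tier, seat p1: Skinner 2016 §3.1 at a (ram)-free pair, ONE-SIDED, in the kernel —
# the Eisenstein half at `f_E` from the Eisenstein halves of the good-ordinary Hida members
# (the transfer of road p1, with its single beyond-print input isolated as ONE field)

Cell `bsd-print-x11a` (run/shared/lean/pub/bsd-print-x11a/), prover seat p1, strategy «Skinner 2016
Thm C variants BY NAME with the ramified-prime hypothesis removed via BCS 2024 base change: type +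
discharge»; third file of the seat (after `PrintSkinnerThmCNoRam.lean` = the discharge ledger and
`PrintEisensteinHalf.lean` = the one-factor socket). HONEST FRAMING: nothing is asserted about any
curve; no pair or class is closed; ONE `Prop`-valued SHAPE with a body (the data a run of Skinner's
§3.1 must supply at a pair; claim-free) and theorems; no named fact; no `sorry`; X11a stays
CONSTRUCTION-SHAPED; no label moves.

WHAT. Skinner, Pacific J. Math. 283 (2016) §3.1 (p. 192) [paper:arxiv-1407.1093 p0013 L12–L60]
proves Thm. A at `p ‖ N` from, for every `m ≥ 1`: (a) a `p`-ordinary newform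
`f_m ∈ S_{k_m}(Γ₀(M))`, `k_m > 2`, `k_m ≡ 2 (mod p − 1)`; (b) `T_f/p^m ≅ T_{f_m}/p^m` (with the
ordinary lines), whence by Lemma (Selmer-modpm) `X^Σ(f)/p^m ≅ X^Σ(f_m)/p^m` over `Λ_𝒪`; (c)
`(𝓛^Σ_f, p^m) = (𝓛^Σ_{f_m}, p^m)` (Prop. 10 = [EPW] two-variable `p`-adic `L`-function); (e) the
main conjecture at `f_m`; (f) `F^Σ(f_m) = Ch^Σ(f_m)` (no finite submodules); then "from basic
properties of Fitting ideals" `(F^Σ(f), p^m) = (𝓛^Σ_f, p^m)` for all `m`, and the limit. Read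
ONE-SIDEDLY — with (e) weakened to the Eisenstein inclusion `Ch^Σ(f_m) ⊆ (𝓛^Σ_{f_m})` — the SAME
argument yields `F^Σ(f) ⊆ (𝓛^Σ_f)` (Krull), and §3.2 (the trivial zero `(γ − 1)^e` between the
Greenberg and the classical Selmer group [p0014 L20–L31]) with §3.3 (canonical vs. Néron period, a
`p`-adic unit under (irr)) and the `Σ`-Euler factors turn this into the ONE-factor display at the
pair: `∃ G ∈ Λ, ι G = ϖ · L_p(E) ∧ (T^e) · ch X(E/ℚ_∞) ⊆ (G)` — the body of
`X11a.EisensteinHalfAt W p` (companion file). The (ram) hypothesis (iii) enters §3.1 ONLY through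
(e) (item (d): "`ρ̄_{f_m} ≅ ρ̄_f` is … ramified at some `q ≠ p`", used to invoke Theorem 9 = SU14 +
Kato at `f_m`). THIS FILE proves the one-sided §3.1 as a kernel theorem over an abstract coefficient
ring `S` (think `Λ_𝒪 = 𝒪⟦T⟧`) receiving `Λ = ℤ_p⟦T⟧`:

* §1 **`span_mul_le_span_of_oneSided_hidaCongruences`** — pure algebra: from
  `φ(T^e · P) · φ(ch X) ⊆ Fitt_S(M)` [(f) at `f` + §3.2 + `Σ`-factors `P`, on the FIXED module
  `M = X^Σ_{ℚ_∞,L}(f)`], `S`-isomorphisms `M/p^m ≅ N_m/p^m` [(b) + Lemma (Selmer-modpm)], member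
  inclusions `Fitt_S(N_m) ⊆ (L_m)` [(e) ONE-SIDED + (f) at `f_m` — THE BEYOND-PRINT FIELD at `¬ Ram`]
  and congruences `(L_m) + (p^m) = (u · φ(G · P)) + (p^m)` [(c) + §3.3: `𝓛^Σ_f = u · φ(G P)`, `u ∈ S^×`],
  conclude `(T^e) · ch X ⊆ (G)` in `Λ` — by the tree's two-ring Krull limit
  `X2.HidaLimitAlgebra.map_le_span_of_oneSided_congruences` (cell bsd-eis), descent along `φ`
  (`φ` reflects principal divisibility: faithful flatness of `ℤ_p⟦T⟧ → 𝒪⟦T⟧`, a HYPOTHESIS on `S`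
  here) and cancellation of `P ≠ 0` in the domain `Λ`.
* §2 **`HidaMembersTransferAt W p`** — the SHAPE (a `Prop` with a body; claim-free): at every datum
  `(κ, γ, f, D, ϖ, L)` of `X2.MazurMainConjectureAt` / `EisensteinHalfAt`, the existence of the §1
  data. Its conjuncts are, field by field, PRINT-SHAPED except ONE: the member inclusions
  `Fitt_S(N_m) ⊆ (L_m)` = "the integral cyclotomic Eisenstein divisibility at the good-ordinary
  members `f_m` of weight `k_m > 2` WITHOUT (mult)" — printed only under (ram) (SU14 Thm. 3.29 /
  Skinner Thm. 9), at weight 2 (BCS 2024 Thm. 1.1.2), or rationally (Wan 2015 Thm. 4): the NAMED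
  residual of road p1 (referee R0-1/R0-2: a sub-crux candidate on the SURJECTIVE sub-leaf only —
  off `Surj`, Kato's integrality (§2.5 (b)) also needs (ram)).
* §3 **`eisensteinHalf_of_hidaMembersTransferAt`** — the shape delivers, at every datum, the body of
  `EisensteinHalfAt W p` (spelled out; the by-name corollary `→ EisensteinHalfAt W p` is a one-line
  append once the companion file is in the tree), hence (companion file, `p ≥ 5`, `Surj`) Mazur's
  main conjecture at the pair, `BSD(E,p)`, and the body of crux 19064 `X11aLowerHalf` there.

NOT here (by design): the member objects themselves (`Skinner2016.HidaCongruentMember W p m` of cell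
bsd-stepL gives (a)+(b) with the Galois-module congruence; the members' cyclotomic Selmer duals and
`p`-adic `L`-functions with canonical periods are GL₂-vocabulary the tree types elsewhere —
`GreenbergSelmer.OrdinaryNewformDatum`, `EmertonPollackWeston2006.HidaFamilyTransfer`); instantiating
the shape's print-shaped fields from them is typer work (Lemma (Selmer-modpm), Prop. 10, §3.2, §3.3,
GV00 Prop. 2.4 as named facts). This file fixes the algebra and the exact shape so that such an
instantiation closes the surjective sub-leaf BY NAME modulo the single member-inclusion field.

References: [Skinner2016PacificMC] §2.6 (2-6-1)–(2-6-3), Prop. 10, §3.1 (a)–(f), §3.2, §3.3;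
[GreenbergVatsal2000] Prop. 2.4 (`Σ`-Euler factors); [EmertonPollackWeston2006] (two-variable
`L`-function); H. Matsumura, *Commutative Ring Theory*, Thm. 7.5 (faithful flatness); tree:
`X2/HidaLimitCongruenceAlgebra.lean` (bsd-eis cgshw), `X11b/IMCCongruenceTransferKrull.lean`,
`X11a/BaseChangeRoute.lean` (`trivialZeroFactor`, `IsTheMultPAdicLFunctionOf`).
-/

set_option autoImplicit false

noncomputable section

open scoped Classical MatrixGroups ModularForm

open CongruenceSubgroup WeierstrassCurve PowerSeries Literature.NumberTheory.EllipticCurves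
  Literature.NumberTheory.EllipticCurves.ModularForms
  Literature.NumberTheory.EllipticCurves.Rank1Residual
  Literature.RingTheory.FittingIdeal

namespace Summit.BirchSwinnertonDyer.Rank1Residual.X11a

/-! ### §1 The one-sided §3.1 over an abstract coefficient ring, descended to `Λ` -/

section Algebra

variable {p : ℕ} [Fact p.Prime] {S : Type*} [CommRing S] [IsNoetherianRing S]

/-- **Skinner 2016 §3.1 read one-sidedly, as pure algebra.** Data: a Noetherian coefficient ring
`S` receiving `Λ = ℤ_p⟦T⟧` along `φ` with `φ(p) ∈ Jac(S)` and `φ` reflecting principal divisibility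
(`φ x ∈ (φ y) ⇒ x ∈ (y)`; for `S = 𝒪⟦T⟧` this is faithful flatness); an ideal `C ⊆ Λ` (`ch X(E/ℚ_∞)`),
elements `t` (the trivial-zero factor `T^e`), `P ≠ 0` (the `Σ`-Euler factors) and `G` (the integral
avatar of `ϖ · L_p(E)`) of `Λ`, a unit `u ∈ S^×` (periods); a finite `S`-module `M` (`X^Σ(f)`) with
`φ(t P) · φ(C) ⊆ Fitt_S(M)`; finite `S`-modules `N_m` (`X^Σ(f_m)`) with `M/p^m ≅ N_m/p^m`; member
inclusions `Fitt_S(N_m) ⊆ (L_m)`; congruences `(L_m) + (p^m) = (u · φ(G P)) + (p^m)`. Conclusion: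
`(t) · C ⊆ (G)` in `Λ`. Proof: the tree's Krull limit `X2.HidaLimitAlgebra.map_le_span_of_oneSided_congruences`
(over `S`, identity map) gives `φ(tP) · φ(C) ⊆ (u φ(GP)) = (φ(GP))`; for `y ∈ (t) · C`,
`φ(yP)` lies there, so `yP ∈ (GP)` by descent and `y ∈ (G)` by cancelling `P` in the domain `Λ`.
[cite: Skinner2016PacificMC, §3.1 (p. 192), read one-sidedly] [cite: StacksProject, Tag 05GI (Krull)] -/
theorem span_mul_le_span_of_oneSided_hidaCongruences (φ : IwasawaAlgebra p →+* S)
    (hJac : (Ideal.span {(C (p : ℤ_[p]) : IwasawaAlgebra p)}).map φ ≤ (⊥ : Ideal S).jacobson)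
    (hdesc : ∀ x y : IwasawaAlgebra p, φ x ∈ Ideal.span {φ y} → x ∈ Ideal.span {y})
    {M : Type*} [AddCommGroup M] [Module S M] [Module.Finite S M]
    (N : ℕ → Type*) [∀ m, AddCommGroup (N m)] [∀ m, Module S (N m)] [∀ m, Module.Finite S (N m)]
    (Cid : Ideal (IwasawaAlgebra p)) {t P G : IwasawaAlgebra p} (hP : P ≠ 0) (u : Sˣ) (Lm : ℕ → S)
    (hM : Ideal.span {φ (t * P)} * Cid.map φ ≤ Module.fittingIdeal S M 0)
    (e : ∀ m : ℕ, 1 ≤ m →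
      ((M ⧸ (((Ideal.span {(C (p : ℤ_[p]) : IwasawaAlgebra p)}).map φ) ^ m •
          (⊤ : Submodule S M))) ≃ₗ[S]
        (N m ⧸ (((Ideal.span {(C (p : ℤ_[p]) : IwasawaAlgebra p)}).map φ) ^ m •
          (⊤ : Submodule S (N m))))))
    (hF : ∀ m : ℕ, 1 ≤ m → Module.fittingIdeal S (N m) 0 ≤ Ideal.span {Lm m})
    (hc : ∀ m : ℕ, 1 ≤ m →
      Ideal.span {Lm m} ⊔ ((Ideal.span {(C (p : ℤ_[p]) : IwasawaAlgebra p)}).map φ) ^ m =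
        Ideal.span {(u : S) * φ (G * P)} ⊔
          ((Ideal.span {(C (p : ℤ_[p]) : IwasawaAlgebra p)}).map φ) ^ m) :
    Ideal.span {t} * Cid ≤ Ideal.span {G} := by
  set I : Ideal S := (Ideal.span {(C (p : ℤ_[p]) : IwasawaAlgebra p)}).map φ with hI
  -- the Krull limit over `S` (identity map)
  have hI' : I.map (RingHom.id S) ≤ (⊥ : Ideal S).jacobson := by rw [Ideal.map_id]; exact hJac
  have e' : ∀ m : ℕ, 1 ≤ m →
      ((M ⧸ (I ^ m • (⊤ : Submodule S M))) ≃ₗ[S] (N m ⧸ (I ^ m • (⊤ : Submodule S (N m))))) :=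
    fun m hm => e m hm
  have hF' : ∀ m : ℕ, 1 ≤ m →
      (Module.fittingIdeal S (N m) 0).map (RingHom.id S) ≤ Ideal.span {Lm m} := by
    intro m hm; rw [Ideal.map_id]; exact hF m hm
  have hc' : ∀ m : ℕ, 1 ≤ m → Ideal.span {Lm m} ⊔ (I.map (RingHom.id S)) ^ m =
      Ideal.span {(u : S) * φ (G * P)} ⊔ (I.map (RingHom.id S)) ^ m := by
    intro m hm; rw [Ideal.map_id]; exact hc m hm
  have key := X2.HidaLimitAlgebra.map_le_span_of_oneSided_congruences (RingHom.id S) I N hI' hM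
    ((u : S) * φ (G * P)) Lm e' hF' hc'
  rw [Ideal.map_id, Ideal.span_singleton_mul_left_unit u.isUnit] at key
  -- descent and cancellation
  intro y hy
  have hyP : y * P ∈ Ideal.span {t * P} * Cid := by
    have h1 : y * P ∈ (Ideal.span {t} * Cid) * Ideal.span {P} :=
      Ideal.mul_mem_mul hy (Ideal.mem_span_singleton_self P)
    have h2 : (Ideal.span {t} * Cid) * Ideal.span {P} = Ideal.span {t * P} * Cid := by
      rw [mul_comm (Ideal.span {t}) Cid, mul_assoc, Ideal.span_singleton_mul_span_singleton,
        mul_comm Cid]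
    rw [h2] at h1
    exact h1
  have hφyP : φ (y * P) ∈ Ideal.span {φ (t * P)} * Cid.map φ := by
    have h3 : (Ideal.span {t * P} * Cid).map φ = Ideal.span {φ (t * P)} * Cid.map φ := by
      rw [Ideal.map_mul, Ideal.map_span, Set.image_singleton]
    rw [← h3]
    exact Ideal.mem_map_of_mem φ hyP
  have hGP : y * P ∈ Ideal.span {G * P} := hdesc _ _ (key hφyP)
  obtain ⟨s, hs⟩ := Ideal.mem_span_singleton'.mp hGP
  refine Ideal.mem_span_singleton'.mpr ⟨s, ?_⟩
  have hs' : s * G * P = y * P := by rw [mul_assoc]; exact hs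
  exact mul_right_cancel₀ hP hs'

end Algebra

/-! ### §2 The shape: what a run of Skinner's §3.1 supplies at a pair -/

section Shape

variable (W : WeierstrassCurve ℚ) (p : ℕ) [Fact p.Prime]

/-- **The Hida-members transfer datum at `(E, p)` (SHAPE of Skinner 2016 §3.1–3.3 read
one-sidedly at a (ram)-free pair; a `Prop` with a body, claim-free — it names what a proof must
supply, asserts nothing).** At every datum of `X2.MazurMainConjectureAt W p` — cyclotomic `(κ, γ)`,
a newform `f` of `W`, a dual datum `D` of `Sel_{p^∞}(E/ℚ_∞)`, `ϖ` with `ϖ · Ω_E = Ω⁺_f`, THE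
multiplicative Mazur–Tate–Teitelbaum function `L` — there are: `G ∈ Λ` with `ι G = ϖ · L` [the
integral avatar of `ϖ L_p(E)`: Kato–Wuthrich A32 / GV00 Prop. 3.7 under (irr)]; `P ∈ Λ`, `P ≠ 0`
[`∏_{ℓ ∈ Σ, ℓ ≠ p} P_ℓ(f)`, the `Σ`-Euler factors, GV00 Prop. 2.4 / SU14 §3]; a Noetherian
coefficient ring `S` (`Λ_𝒪 = 𝒪⟦T⟧`, `𝒪 ⊇ ℤ_p[a_ℓ(f_m)]` for all `m`, [Ski16] §2.6 "after possibly
replacing `L` with a finite extension") with `φ : Λ → S`, `φ(p) ∈ Jac(S)`, `φ` reflecting principal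
divisibility [faithful flatness, Matsumura Thm. 7.5]; a finite `S`-module `M` [`X^Σ_{ℚ_∞,L}(f)`]
with `φ(T^e P) · φ(ch X) ⊆ Fitt_S(M)` [§3.1 (f) at `f` (`F^Σ(f) = Ch^Σ(f)`, Prop. SelStruct2 +
Lemma Ch-Fitt) ∘ §3.2 (`Ch_L(f) = Ch_L(f)' · (γ − 1)^e`, p0014 L20–L31) ∘ the `Σ`-factors ∘
`Ch_L(f)' = ch X(E/ℚ_∞) · Λ_𝒪`]; finite `S`-modules `N_m` [`X^Σ_{ℚ_∞,L}(f_m)`, the members (a)] with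
`S`-isomorphisms `M/p^m ≅ N_m/p^m` [(b) (2-6-1)–(2-6-2) + Lemma (Selmer-modpm), dualised]; a unit
`u ∈ S^×` and `L_m ∈ S` [`𝓛^Σ_{f_m}`] with `(L_m) + (p^m) = (u · φ(G P)) + (p^m)` [(c) = (2-6-3),
Prop. 10 ([EPW]); `𝓛^Σ_f = u · φ(G P)`: §3.3, canonical vs. Néron period a `p`-adic unit under
(irr)]; and the MEMBER INCLUSIONS `Fitt_S(N_m) ⊆ (L_m)` [(e) one-sided ∘ (f): the integral
cyclotomic Eisenstein divisibility `Ch^Σ(f_m) ⊆ (𝓛^Σ_{f_m})` at the good-ordinary members of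
weight `k_m > 2` — in print ONLY under (ram) (Thm. 9 = SU14 + Kato), at weight 2 (BCS 2024
Thm. 1.1.2) or in `Λ ⊗ ℚ_p` (Wan 2015 Thm. 4): THE beyond-print field of road p1 at `¬ Ram`, a
sub-crux candidate on the surjective sub-leaf only (referee R0-2)]. Every other bracket is a
printed statement awaiting typing against the tree's GL₂ vocabulary; nothing here is a fact.
[cite: Skinner2016PacificMC, §2.6, Prop. 10, §3.1 (a)–(f), §3.2–3.3 (shape only; nothing asserted)]
[cite: GreenbergVatsal2000, Prop. 2.4 (shape only)] -/
def HidaMembersTransferAt : Prop :=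
  ∀ (κ : ZpExtension ℚ p) (γ : Field.absoluteGaloisGroup ℚ),
      κ.IsCyclotomic → κ.IsTopGenerator γ → IsCyclotomicVariable p γ →
    ∀ {N : ℕ} [NeZero N] (f : CuspForm (Gamma0 N) 2), IsNewformOf W f →
    ∀ (D : W.SelmerDualData κ γ) (ϖ : ℚ), (ϖ : ℝ) * W.realPeriodRat = plusPeriod f →
    ∀ (L : PowerSeries ℚ_[p]), IsTheMultPAdicLFunctionOf W f p L →
    ∃ (G P : IwasawaAlgebra p),
      iwasawaToPowerSeries p G = PowerSeries.C ((ϖ : ℚ) : ℚ_[p]) * L ∧ P ≠ 0 ∧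
    ∃ (S : Type) (_ : CommRing S) (_ : IsNoetherianRing S) (φ : IwasawaAlgebra p →+* S),
      (Ideal.span {(C (p : ℤ_[p]) : IwasawaAlgebra p)}).map φ ≤ (⊥ : Ideal S).jacobson ∧
      (∀ x y : IwasawaAlgebra p, φ x ∈ Ideal.span {φ y} → x ∈ Ideal.span {y}) ∧
    ∃ (M : Type) (_ : AddCommGroup M) (_ : Module S M) (_ : Module.Finite S M)
      (Nm : ℕ → Type) (_ : ∀ m, AddCommGroup (Nm m)) (_ : ∀ m, Module S (Nm m))
      (_ : ∀ m, Module.Finite S (Nm m)) (u : Sˣ) (Lm : ℕ → S),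
      Ideal.span {φ (trivialZeroFactor W p * P)} * D.charIdeal.map φ ≤ Module.fittingIdeal S M 0 ∧
      (∀ m : ℕ, 1 ≤ m → Nonempty
        ((M ⧸ (((Ideal.span {(C (p : ℤ_[p]) : IwasawaAlgebra p)}).map φ) ^ m •
            (⊤ : Submodule S M))) ≃ₗ[S]
          (Nm m ⧸ (((Ideal.span {(C (p : ℤ_[p]) : IwasawaAlgebra p)}).map φ) ^ m •
            (⊤ : Submodule S (Nm m)))))) ∧
      (∀ m : ℕ, 1 ≤ m → Module.fittingIdeal S (Nm m) 0 ≤ Ideal.span {Lm m}) ∧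
      (∀ m : ℕ, 1 ≤ m →
        Ideal.span {Lm m} ⊔ ((Ideal.span {(C (p : ℤ_[p]) : IwasawaAlgebra p)}).map φ) ^ m =
          Ideal.span {(u : S) * φ (G * P)} ⊔
            ((Ideal.span {(C (p : ℤ_[p]) : IwasawaAlgebra p)}).map φ) ^ m)

end Shape

/-! ### §3 The shape delivers the one-factor Eisenstein display at every datum -/

section Main

variable (W : WeierstrassCurve ℚ) (p : ℕ) [Fact p.Prime]

/-- **Skinner's §3.1 transfer, one-sided, at a pair: the Hida-members datum yields the one-factor
Eisenstein display** `∃ G ∈ Λ, ι G = ϖ · L ∧ (T^e) · ch X(E/ℚ_∞) ⊆ (G)` at every datum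
`(κ, γ, f, D, ϖ, L)` — verbatim the body of the companion file's `X11a.EisensteinHalfAt W p`
(which, for `p ≥ 5` multiplicative with `ρ̄_{E,p}` onto, is Mazur's main conjecture at the pair by
Kato–Wuthrich, hence `BSD(E,p)` on the surjective X11a sub-leaf and the body of crux 19064
`X11aLowerHalf` there). CONDITIONAL on the shape, whose single beyond-print field is the members'
Eisenstein inclusion. [cite: Skinner2016PacificMC, §3.1–3.3 (one-sided reading)] -/
theorem eisensteinHalf_of_hidaMembersTransferAt (h : HidaMembersTransferAt W p)
    (κ : ZpExtension ℚ p) (γ : Field.absoluteGaloisGroup ℚ) (hκ : κ.IsCyclotomic)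
    (hγ : κ.IsTopGenerator γ) (hγ' : IsCyclotomicVariable p γ) {N : ℕ} [NeZero N]
    (f : CuspForm (Gamma0 N) 2) (hf : IsNewformOf W f) (D : W.SelmerDualData κ γ) (ϖ : ℚ)
    (hϖ : (ϖ : ℝ) * W.realPeriodRat = plusPeriod f) (L : PowerSeries ℚ_[p])
    (hL : IsTheMultPAdicLFunctionOf W f p L) :
    ∃ G : IwasawaAlgebra p,
      iwasawaToPowerSeries p G = PowerSeries.C ((ϖ : ℚ) : ℚ_[p]) * L ∧
        Ideal.span {trivialZeroFactor W p} * D.charIdeal ≤ Ideal.span {G} := by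
  obtain ⟨G, P, hG, hP, S, _, _, φ, hJac, hdesc, M, _, _, _, Nm, _, _, _, u, Lm, hM, e, hF, hc⟩ :=
    h κ γ hκ hγ hγ' f hf D ϖ hϖ L hL
  exact ⟨G, hG, span_mul_le_span_of_oneSided_hidaCongruences φ hJac hdesc Nm D.charIdeal hP u Lm
    hM (fun m hm => (e m hm).some) hF hc⟩

end Main

end Summit.BirchSwinnertonDyer.Rank1Residual.X11a

end
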